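import Summits.CriticalPhenomena.SAWScalingLimit.Theorems.SAWDefectDecoherenceBoundaryClosureRInnerPolygonsTrapezoid
import Summits.CriticalPhenomena.SAWScalingLimit.Theorems.SAWDefectDecoherenceBoundaryClosureRInnerPolygonsHalfLattice
import Summits.CriticalPhenomena.SAWScalingLimit.Theorems.SAWDefectDecoherencePolygonParitySqueezeDefs
import Literature.Probability.Percolation.TriLatticeCells
import HarnessLib

/-!
# Crux `BoundaryClosureR` (stmt-CriticalPhenomena-14004), line `polygon-parity-squeeze`,
# stub `stub_innerZigzagPolygon` (7a): the grid of the inner polygon — similarity, mesh, the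
# trapezoid and deep-tile face sets, depth bookkeeping

Landing target:
`Summits/CriticalPhenomena/SAWScalingLimit/Theorems/SAWDefectDecoherenceBoundaryClosureRInnerZigzagGrid.lean`
(`--supports stmt-CriticalPhenomena-14004`; building block A2 of the registered stub
`stub_innerZigzagPolygon`, the continuum half of the inner-polygon construction (IP)).

The inner polygon of the datum `(Ω; pt 0, pt 1)` is built on the triangular grid
`w ↦ pt 1 + h·w` (`w ∈ triEmbed (Site 2)`), with mesh `h` chosen so that BOTH pin lines are grid lines
(`Im (pt 0 - pt 1) = N·h·√3/2`, `exists_mesh`), from the face set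
`K = tileFaces S ∪ R₁ ∪ R₀`: super-hexagon tiles whose centres are `5h`-deep in `Ω` and two grid
trapezoids of `20` rows standing on the two pins.  This file provides the real-variable
bookkeeping, all in the normalised coordinate `w` (real point `o + h·w`):

* the similarity `w ↦ o + h·w` (`dist_sim`, `sim_mem_ball_iff`, `sim_mem_halfPlane_iff`, …);
* `exists_mesh` — a mesh `0 < h ≤ ε` with `Δ = N·h·√3/2`; `exists_trapezoid`, `exists_deepTiles` — the
  trapezoid face set and the deep-tile centre set, existentially with their membership tests;
* depth: `le_infDist_of_ball_subset`, `depth_flat_ball`, `mem_of_infDist_pos`;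
* cells versus depth: `vertex_coords_near`, `tile_cell_deep`, `mem_tileFaces_of_deep`,
  `trapezoid_cell_bounds` (cells of a trapezoid lie above its base row, near its base point).

Sources: folklore.  No proposition is defined and no named fact is introduced.
-/

noncomputable section

open scoped ComplexConjugate
open Set Metric Literature.Probability.LatticeModels
open Literature.Probability.Percolation (triX triY triCell cellForm triX_triEmbed triY_triEmbed coords_of_mem_triCell)
open Literature.Probability.RandomPlanarGeometry
open Literature.Probability.RandomPlanarGeometry.SAW (site_two_eq_iff)
open Summit.CriticalPhenomena.SAWScalingLimit.Theorems.PolygonParitySqueeze.BoundaryWalk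

namespace Summit.CriticalPhenomena.SAWScalingLimit.Theorems.PolygonParitySqueeze.InnerZigzag

/-! ### 1. The similarity `w ↦ o + h·w` -/

/-- Differences under the similarity. [folklore] -/
theorem sim_sub (o : ℂ) (h : ℝ) (w w' : ℂ) : (o + h * w) - (o + h * w') = (h : ℂ) * (w - w') := by ring

/-- Distances scale by `h`. [folklore] -/
theorem dist_sim (o : ℂ) {h : ℝ} (hh : 0 ≤ h) (w w' : ℂ) : dist (o + h * w) (o + h * w') = h * dist w w' := by
  rw [dist_eq_norm, sim_sub, norm_mul, Complex.norm_real, Real.norm_of_nonneg hh, dist_eq_norm]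

/-- Balls correspond under the similarity. [folklore] -/
theorem sim_mem_ball_iff (o : ℂ) {h : ℝ} (hh : 0 < h) {w c : ℂ} {s : ℝ} :
    o + h * w ∈ ball (o + h * c) s ↔ w ∈ ball c (s / h) := by
  rw [mem_ball, mem_ball, dist_sim o hh.le, lt_div_iff₀ hh, mul_comm]

/-- Imaginary parts under the similarity. [folklore] -/
theorem im_sim (o : ℂ) (h : ℝ) (w : ℂ) : (o + h * w).im = o.im + h * w.im := by simp

/-- Levels scale by `h`. [folklore] -/
theorem level_sim (o : ℂ) (h : ℝ) (n w c : ℂ) :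
    (((o + h * w) - (o + h * c)) * conj n).re = h * ((w - c) * conj n).re := by
  rw [sim_sub, mul_assoc, Complex.re_ofReal_mul]

/-- Half-planes correspond under the similarity. [folklore] -/
theorem sim_mem_halfPlane_iff (o : ℂ) {h : ℝ} (hh : 0 < h) (k : Fin 6) (w c : ℂ) :
    o + h * w ∈ halfPlane k (o + h * c) ↔ w ∈ halfPlane k c := by
  rw [mem_halfPlane_iff_level, mem_halfPlane_iff_level, level_sim]
  exact mul_pos_iff_of_pos_left hh

/-- The upper half-plane above `o + h·c` corresponds to the upper half-plane above `c`. [folklore] -/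
theorem sim_im_lt_iff (o : ℂ) {h : ℝ} (hh : 0 < h) (w c : ℂ) : (o + h * c).im < (o + h * w).im ↔ c.im < w.im := by
  rw [im_sim, im_sim, add_lt_add_iff_left]
  exact ⟨fun h' => lt_of_mul_lt_mul_left h' hh.le, fun h' => mul_lt_mul_of_pos_left h' hh⟩

/-! ### 2. The mesh -/

/-- **A mesh making a given height a whole number of rows**: for every `Δ` and `ε > 0` there are
`0 < h ≤ ε` and `N : ℤ` with `Δ = N·h·(√3/2)`. [folklore] -/
theorem exists_mesh (Δ ε : ℝ) (hε : 0 < ε) :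
    ∃ h : ℝ, 0 < h ∧ h ≤ ε ∧ ∃ N : ℤ, Δ = N * (h * (Real.sqrt 3 / 2)) := by
  set c : ℝ := Real.sqrt 3 / 2 with hc
  have hcpos : 0 < c := by rw [hc]; positivity
  by_cases hΔ : Δ = 0
  · exact ⟨ε, hε, le_rfl, 0, by simp [hΔ]⟩
  · have hΔpos : 0 < |Δ| := abs_pos.2 hΔ
    set n : ℕ := ⌈|Δ| / (ε * c)⌉₊ with hn
    have hn1 : |Δ| / (ε * c) ≤ n := Nat.le_ceil _
    have hnpos : (0 : ℝ) < n := lt_of_lt_of_le (by positivity) hn1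
    set h : ℝ := |Δ| / (n * c) with hh
    have hhpos : 0 < h := by rw [hh]; positivity
    have hhle : h ≤ ε := by
      rw [hh, div_le_iff₀ (by positivity)]
      rw [div_le_iff₀ (by positivity)] at hn1
      nlinarith
    refine ⟨h, hhpos, hhle, if 0 ≤ Δ then (n : ℤ) else -(n : ℤ), ?_⟩
    have key : (n : ℝ) * (h * c) = |Δ| := by
      rw [hh]; field_simp
    split_ifs with hsign
    · rw [abs_of_nonneg hsign] at key
      push_cast
      linarith
    · rw [abs_of_neg (not_le.1 hsign)] at key
      push_cast
      linarith

/-! ### 3. The trapezoid and deep-tile face sets -/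

/-- The box of sites `|x i| ≤ M` (as a `Fintype.piFinset`). [folklore] -/
theorem mem_piFinset_Icc_iff (M : ℕ) (x : Site 2) :
    x ∈ Fintype.piFinset (fun _ : Fin 2 => Finset.Icc (-(M : ℤ)) M) ↔ ∀ i, -(M : ℤ) ≤ x i ∧ x i ≤ M := by
  simp [Fintype.mem_piFinset]

/-- **The trapezoid face set**, existentially: for `0 ≤ a, b, H` there is a finite face set `R` with
`F ∈ R ↔` all vertices `v` of `F` satisfy `Y₀ ≤ v₁ ≤ Y₀ + H`, `X₀ - a ≤ v₀`, `(v₀ - X₀) + (v₁ - Y₀) ≤ b`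
(the membership test of `trapezoid_union_tiles_noPinch`). [folklore] -/
theorem exists_trapezoid (a b H X₀ Y₀ : ℤ) (ha : 0 ≤ a) (hb : 0 ≤ b) (hH : 0 ≤ H) :
    ∃ R : Finset HexVertex, ∀ F : HexVertex, F ∈ R ↔
      ∀ v ∈ hexFaceVertices F, Y₀ ≤ v 1 ∧ v 1 ≤ Y₀ + H ∧ X₀ - a ≤ v 0 ∧ (v 0 - X₀) + (v 1 - Y₀) ≤ b := by
  classical
  set M : ℕ := (|X₀| + a + b + |Y₀| + H + 2).toNat with hM
  have hMge : |X₀| + a + b + |Y₀| + H + 2 ≤ (M : ℤ) := by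
    rw [hM, Int.toNat_of_nonneg (by positivity)]
  refine ⟨((Fintype.piFinset fun _ : Fin 2 => Finset.Icc (-(M : ℤ)) M) ×ˢ (Finset.univ : Finset (Fin 2))).filter
    fun F => ∀ v ∈ hexFaceVertices F, Y₀ ≤ v 1 ∧ v 1 ≤ Y₀ + H ∧ X₀ - a ≤ v 0 ∧ (v 0 - X₀) + (v 1 - Y₀) ≤ b,
    fun F => ?_⟩
  rw [Finset.mem_filter, Finset.mem_product, mem_piFinset_Icc_iff]
  constructor
  · exact fun h => h.2
  · intro hF
    refine ⟨⟨fun i => ?_, Finset.mem_univ _⟩, hF⟩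
    -- a vertex with the coordinates of `F.1` up to `1`
    obtain ⟨x, t⟩ := F
    have hv : (x + Pi.single 0 1) ∈ hexFaceVertices (x, t) ∧ (x + Pi.single 1 1) ∈ hexFaceVertices (x, t) := by
      fin_cases t <;> simp [hexFaceVertices]
    obtain ⟨h1, h2, h3, h4⟩ := hF _ hv.1
    obtain ⟨g1, g2, g3, g4⟩ := hF _ hv.2
    simp at h1 h2 h3 h4 g1 g2 g3 g4
    have hx0 : |x 0| ≤ |X₀| + a + b + |Y₀| + H + 2 := by
      rw [abs_le]; constructor <;> cases abs_cases X₀ <;> cases abs_cases Y₀ <;> omega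
    have hx1 : |x 1| ≤ |X₀| + a + b + |Y₀| + H + 2 := by
      rw [abs_le]; constructor <;> cases abs_cases X₀ <;> cases abs_cases Y₀ <;> omega
    fin_cases i
    · exact abs_le.1 (hx0.trans hMge)
    · exact abs_le.1 (hx1.trans hMge)

/-- Lattice coordinates are bounded by twice the norm (crude). [folklore] -/
theorem abs_coords_le (w : ℂ) : |triX w| ≤ 2 * ‖w‖ ∧ |triY w| ≤ 2 * ‖w‖ := by
  have h1 := Literature.Probability.Percolation.abs_triX_sub_le w 0
  have h2 := Literature.Probability.Percolation.abs_triY_sub_le w 0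
  simp [Literature.Probability.Percolation.triX, Literature.Probability.Percolation.triY] at h1 h2 ⊢
  exact ⟨h1, h2⟩

/-- **The deep-tile centre set**, existentially: for a bounded `Ω`, `0 < h` and `0 < η₁` there is a
finite set `S` of sites with `c ∈ S ↔ c₀ ≡ c₁ (mod 3) ∧ η₁ ≤ infDist (o + h·triEmbed c) Ωᶜ`.
[folklore] -/
theorem exists_deepTiles (Ω : Set ℂ) (hΩ : Bornology.IsBounded Ω) (o : ℂ) {h η₁ : ℝ} (hh : 0 < h) (hη : 0 < η₁) :
    ∃ S : Finset (Site 2), ∀ c : Site 2, c ∈ S ↔ (c 0 - c 1) % 3 = 0 ∧ η₁ ≤ infDist (o + h * triEmbed c) Ωᶜ := by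
  classical
  obtain ⟨Rad, hRad⟩ := hΩ.subset_ball o
  set M : ℕ := ⌈2 * (|Rad| / h)⌉₊ with hM
  refine ⟨(Fintype.piFinset fun _ : Fin 2 => Finset.Icc (-(M : ℤ)) M).filter fun c =>
    (c 0 - c 1) % 3 = 0 ∧ η₁ ≤ infDist (o + h * triEmbed c) Ωᶜ, fun c => ?_⟩
  rw [Finset.mem_filter, mem_piFinset_Icc_iff]
  constructor
  · exact fun h => h.2
  · rintro ⟨h1, h2⟩
    refine ⟨fun i => ?_, h1, h2⟩
    -- the centre is in `Ω ⊆ ball o Rad`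
    have hin : o + h * triEmbed c ∈ Ω := by
      by_contra hc
      have : infDist (o + ↑h * triEmbed c) Ωᶜ = 0 := infDist_zero_of_mem hc
      linarith
    have hball := hRad hin
    rw [mem_ball, dist_eq_norm, add_sub_cancel_left, norm_mul, Complex.norm_real, Real.norm_of_nonneg hh.le] at hball
    have hnorm : ‖triEmbed c‖ < |Rad| / h := by
      rw [lt_div_iff₀ hh]; nlinarith [le_abs_self Rad]
    obtain ⟨hX, hY⟩ := abs_coords_le (triEmbed c)
    rw [triX_triEmbed] at hX
    rw [triY_triEmbed] at hY
    have hMge : 2 * (|Rad| / h) ≤ M := Nat.le_ceil _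
    fin_cases i
    · have : |((c 0 : ℤ) : ℝ)| ≤ M := by linarith
      have h' : |c 0| ≤ (M : ℤ) := by exact_mod_cast this
      exact abs_le.1 h'
    · have : |((c 1 : ℤ) : ℝ)| ≤ M := by linarith
      have h' : |c 1| ≤ (M : ℤ) := by exact_mod_cast this
      exact abs_le.1 h'

/-! ### 4. Depth -/

/-- A ball inside `Ω` bounds the depth from below. [folklore] -/
theorem le_infDist_of_ball_subset {Ω : Set ℂ} (hΩ : Ωᶜ.Nonempty) {z : ℂ} {δ : ℝ} (h : ball z δ ⊆ Ω) :
    δ ≤ infDist z Ωᶜ := by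
  rw [le_infDist hΩ]
  intro y hy
  by_contra hlt
  exact hy (h (mem_ball'.2 (not_le.1 hlt)))

/-- **Depth inside a flat pinned ball**: if `Ω ∩ ball x ρ` is the open upper half-ball, every
point `z` has depth at least `min (im z - im x) (ρ - dist z x)`. [folklore] -/
theorem depth_flat_ball {Ω : Set ℂ} (hΩ : Ωᶜ.Nonempty) {x : ℂ} {ρ : ℝ}
    (hflat : Ω ∩ ball x ρ = {z : ℂ | x.im < z.im} ∩ ball x ρ) (z : ℂ) :
    min (z.im - x.im) (ρ - dist z x) ≤ infDist z Ωᶜ := by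
  apply le_infDist_of_ball_subset hΩ
  intro y hy
  rw [mem_ball] at hy
  have hy1 : dist y z < z.im - x.im := lt_of_lt_of_le hy (min_le_left _ _)
  have hy2 : dist y z < ρ - dist z x := lt_of_lt_of_le hy (min_le_right _ _)
  have hmem : y ∈ {z : ℂ | x.im < z.im} ∩ ball x ρ := by
    refine ⟨?_, ?_⟩
    · have := Complex.abs_im_le_norm (y - z)
      rw [Complex.sub_im] at this
      rw [dist_eq_norm] at hy1
      simp only [mem_setOf_eq]
      linarith [neg_abs_le (y.im - z.im)]
    · rw [mem_ball]
      linarith [dist_triangle y z x]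
  rw [← hflat] at hmem
  exact hmem.1

/-- A point of positive depth is in `Ω`. [folklore] -/
theorem mem_of_infDist_pos {Ω : Set ℂ} {z : ℂ} (h : 0 < infDist z Ωᶜ) : z ∈ Ω := by
  by_contra hz
  have := infDist_zero_of_mem (s := Ωᶜ) hz
  linarith

/-! ### 5. Cells versus depth -/

/-- **The vertices of a cell containing `w` have lattice coordinates within `1` of those of `w`.**
[folklore] -/
theorem vertex_coords_near {F : HexVertex} {w : ℂ} (hw : w ∈ triCell F) {v : Site 2} (hv : v ∈ hexFaceVertices F) :
    triX w - 1 ≤ v 0 ∧ (v 0 : ℝ) ≤ triX w + 1 ∧ triY w - 1 ≤ v 1 ∧ (v 1 : ℝ) ≤ triY w + 1 ∧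
      triX w + triY w - 1 ≤ (v 0 : ℝ) + v 1 ∧ (v 0 : ℝ) + v 1 ≤ triX w + triY w + 1 := by
  obtain ⟨c1, c2, c3, c4⟩ := coords_of_mem_triCell hw
  have h0 := hw 0
  have h1 := hw 1
  obtain ⟨x, t⟩ := F
  fin_cases t <;> simp [cellForm] at h0 h1 <;> simp [hexFaceVertices] at hv <;> simp only at c1 c2 c3 c4 <;>
    rcases hv with rfl | rfl | rfl <;> simp <;> refine ⟨?_, ?_, ?_, ?_, ?_, ?_⟩ <;> linarith

/-- A cell point is within `4h` of each vertex of the cell, after the similarity. [folklore] -/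
theorem dist_sim_vertex_le (o : ℂ) {h : ℝ} (hh : 0 ≤ h) {F : HexVertex} {w : ℂ} (hw : w ∈ triCell F) {v : Site 2}
    (hv : v ∈ hexFaceVertices F) : dist (o + h * w) (o + h * triEmbed v) ≤ 4 * h := by
  rw [dist_sim o hh, dist_eq_norm, mul_comm]
  exact mul_le_mul_of_nonneg_right (norm_sub_triEmbed_vertex_le' hw hv) hh
  where
  /-- local copy of the crude vertex bound (cells are within `4` of their vertices). [folklore] -/
  norm_sub_triEmbed_vertex_le' {F : HexVertex} {w : ℂ} {v : Site 2} (hw : w ∈ triCell F)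
      (hv : v ∈ hexFaceVertices F) : ‖w - triEmbed v‖ ≤ 4 := by
    have hvc : triEmbed v ∈ triCell F := by
      obtain ⟨x, t⟩ := F
      rw [Literature.Probability.Percolation.mem_triCell_iff]
      intro j
      fin_cases t <;> simp [hexFaceVertices] at hv <;> rcases hv with rfl | rfl | rfl <;> fin_cases j <;>
        simp [cellForm, triX_triEmbed, triY_triEmbed] <;> linarith
    have h1 := Literature.Probability.Percolation.norm_sub_triEmbed_le_of_mem_triCell hw
    have h2 := Literature.Probability.Percolation.norm_sub_triEmbed_le_of_mem_triCell hvc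
    calc ‖w - triEmbed v‖ = ‖(w - triEmbed F.1) - (triEmbed v - triEmbed F.1)‖ := by ring_nf
      _ ≤ ‖w - triEmbed F.1‖ + ‖triEmbed v - triEmbed F.1‖ := norm_sub_le _ _
      _ ≤ 4 := by linarith

/-- **Cells of deep tiles are deep**: if every centre in `S` is `η₁`-deep then every point of a cell
of `tileFaces S` is `(η₁ - 4h)`-deep. [folklore] -/
theorem tile_cell_deep {Ω : Set ℂ} (o : ℂ) {h η₁ : ℝ} (hh : 0 ≤ h) {S : Finset (Site 2)}
    (hS : ∀ c ∈ S, η₁ ≤ infDist (o + h * triEmbed c) Ωᶜ) {F : HexVertex} (hF : F ∈ tileFaces S) {w : ℂ}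
    (hw : w ∈ triCell F) : η₁ - 4 * h ≤ infDist (o + h * w) Ωᶜ := by
  obtain ⟨c, hcS, hcF⟩ := (mem_tileFaces_iff S F).1 hF
  have h1 := hS c hcS
  have h2 := infDist_le_infDist_add_dist (s := Ωᶜ) (x := o + h * triEmbed c) (y := o + h * w)
  have h3 := dist_sim_vertex_le o hh hw hcF
  rw [dist_comm] at h3
  linarith

/-- **A cell containing a deep point is a tile face**: if `S` contains every `η₁`-deep centre and
`w ∈ triCell F` is `(η₁ + 4h)`-deep then `F ∈ tileFaces S`. [folklore] -/
theorem mem_tileFaces_of_deep {Ω : Set ℂ} (o : ℂ) {h η₁ : ℝ} (hh : 0 ≤ h) {S : Finset (Site 2)}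
    (hS : ∀ c : Site 2, (c 0 - c 1) % 3 = 0 → η₁ ≤ infDist (o + h * triEmbed c) Ωᶜ → c ∈ S)
    {F : HexVertex} {w : ℂ} (hw : w ∈ triCell F) (hdeep : η₁ + 4 * h ≤ infDist (o + h * w) Ωᶜ) :
    F ∈ tileFaces S := by
  obtain ⟨c, hcF, hc3⟩ := exists_centre_vertex' F
  refine (mem_tileFaces_iff S F).2 ⟨c, hS c hc3 ?_, hcF⟩
  have h2 := infDist_le_infDist_add_dist (s := Ωᶜ) (x := o + h * w) (y := o + h * triEmbed c)
  have h3 := dist_sim_vertex_le o hh hw hcF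
  linarith
  where
  /-- local copy: every face has a vertex on the index-`3` sublattice. [folklore] -/
  exists_centre_vertex' (F : HexVertex) : ∃ c ∈ hexFaceVertices F, (c 0 - c 1) % 3 = 0 := by
    obtain ⟨x, t⟩ := F
    have h3 : (x 0 - x 1) % 3 = 0 ∨ (x 0 - x 1) % 3 = 1 ∨ (x 0 - x 1) % 3 = 2 := by omega
    fin_cases t
    · rcases h3 with h | h | h
      · exact ⟨x, by simp [hexFaceVertices], h⟩
      · exact ⟨x + Pi.single 1 1, by simp [hexFaceVertices], by simp; omega⟩
      · exact ⟨x + Pi.single 0 1, by simp [hexFaceVertices], by simp; omega⟩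
    · rcases h3 with h | h | h
      · exact ⟨x + Pi.single 0 1 + Pi.single 1 1, by simp [hexFaceVertices], by simp; omega⟩
      · exact ⟨x + Pi.single 1 1, by simp [hexFaceVertices], by simp; omega⟩
      · exact ⟨x + Pi.single 0 1, by simp [hexFaceVertices], by simp; omega⟩

/-- `im w = (√3/2)·Y(w)`. [folklore] -/
theorem im_eq_triY (w : ℂ) : w.im = Real.sqrt 3 / 2 * triY w := by
  have h3 : Real.sqrt 3 ≠ 0 := by positivity
  simp only [Literature.Probability.Percolation.triY]
  field_simp

/-- `re w = X(w) + Y(w)/2`. [folklore] -/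
theorem re_eq_triX_add (w : ℂ) : w.re = triX w + triY w / 2 := by
  have h3 : Real.sqrt 3 ≠ 0 := by positivity
  simp only [Literature.Probability.Percolation.triX, Literature.Probability.Percolation.triY]
  field_simp
  ring

/-- The norm of a lattice point in lattice coordinates (crude): `‖triEmbed v‖ ≤ A` once
`|v₀| + |v₁| ≤ A`. [folklore] -/
theorem norm_triEmbed_le (v : Site 2) {A : ℝ} (hA : |(v 0 : ℝ)| + |(v 1 : ℝ)| ≤ A) : ‖triEmbed v‖ ≤ A := by
  refine le_trans ?_ hA
  have hz : ‖triZeta‖ = 1 := by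
    rw [Complex.norm_eq_sqrt_sq_add_sq, triZeta_re, triZeta_im]
    have h3 : Real.sqrt 3 ^ 2 = 3 := Real.sq_sqrt (by norm_num)
    rw [show ((1 : ℝ) / 2) ^ 2 + (Real.sqrt 3 / 2) ^ 2 = 1 by nlinarith [h3], Real.sqrt_one]
  calc ‖triEmbed v‖ = ‖((v 0 : ℤ) : ℂ) + ((v 1 : ℤ) : ℂ) * triZeta‖ := rfl
    _ ≤ ‖((v 0 : ℤ) : ℂ)‖ + ‖((v 1 : ℤ) : ℂ) * triZeta‖ := norm_add_le _ _
    _ = |(v 0 : ℝ)| + |(v 1 : ℝ)| := by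
      rw [norm_mul, hz, mul_one, Complex.norm_intCast, Complex.norm_intCast]

/-- **Cells of a trapezoid lie above its base row and near its base point**: for `F` in the face
set of the trapezoid with data `a b H X₀ Y₀` and `w ∈ triCell F`, `(√3/2)·Y₀ ≤ im w` and
`‖w - triEmbed ![X₀, Y₀]‖ ≤ max a b + H + 4`. [folklore] -/
theorem trapezoid_cell_bounds {R : Finset HexVertex} {a b H X₀ Y₀ : ℤ} (ha : 0 ≤ a) (hb : 0 ≤ b) (hH : 0 ≤ H)
    (hR : ∀ F : HexVertex, F ∈ R ↔
      ∀ v ∈ hexFaceVertices F, Y₀ ≤ v 1 ∧ v 1 ≤ Y₀ + H ∧ X₀ - a ≤ v 0 ∧ (v 0 - X₀) + (v 1 - Y₀) ≤ b)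
    {F : HexVertex} (hF : F ∈ R) {w : ℂ} (hw : w ∈ triCell F) :
    Real.sqrt 3 / 2 * Y₀ ≤ w.im ∧ ‖w - triEmbed ![X₀, Y₀]‖ ≤ max a b + H + 4 := by
  have hRF := (hR F).1 hF
  obtain ⟨x, t⟩ := F
  -- the vertex `x + e₁` is a vertex of both face types, with coordinates `(x₀, x₁ + 1)`
  have hv : (x + Pi.single 1 1) ∈ hexFaceVertices (x, t) := by fin_cases t <;> simp [hexFaceVertices]
  have hv0 : (x + Pi.single 0 1) ∈ hexFaceVertices (x, t) := by fin_cases t <;> simp [hexFaceVertices]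
  obtain ⟨h1, h2, h3, h4⟩ := hRF _ hv
  obtain ⟨g1, -, g3, -⟩ := hRF _ hv0
  simp at h1 h2 h3 h4 g1 g3
  obtain ⟨c1, c2, c3, c4⟩ := coords_of_mem_triCell hw
  simp only at c1 c2 c3 c4
  have hY0 : (Y₀ : ℝ) ≤ triY w := by
    have : (Y₀ : ℝ) ≤ x 1 := by exact_mod_cast g1
    linarith
  constructor
  · rw [im_eq_triY]
    have := sqrt_three_div_two_pos'
    nlinarith
  · have hd := dist_sim_vertex_le 0 zero_le_one hw hv
    simp only [zero_add, Complex.ofReal_one, one_mul, mul_one, dist_eq_norm] at hd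
    have hdiff : ‖triEmbed (x + Pi.single 1 1) - triEmbed ![X₀, Y₀]‖ ≤ max a b + H := by
      rw [← triEmbed_sub]
      refine norm_triEmbed_le _ ?_
      have e0 : (x + Pi.single 1 1 - ![X₀, Y₀] : Site 2) 0 = x 0 - X₀ := by simp
      have e1 : (x + Pi.single 1 1 - ![X₀, Y₀] : Site 2) 1 = x 1 + 1 - Y₀ := by simp
      rw [e0, e1]
      push_cast
      have ha' : (0 : ℝ) ≤ a := by exact_mod_cast ha
      have hb' : (0 : ℝ) ≤ b := by exact_mod_cast hb
      have hH' : (0 : ℝ) ≤ H := by exact_mod_cast hH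
      have h3' : (X₀ : ℝ) ≤ x 0 + a := by exact_mod_cast h3
      have h4' : ((x 0 : ℝ) - X₀) + (x 1 + 1 - Y₀) ≤ b := by exact_mod_cast h4
      have h1' : (Y₀ : ℝ) ≤ x 1 + 1 := by exact_mod_cast h1
      have h2' : (x 1 : ℝ) + 1 ≤ Y₀ + H := by exact_mod_cast Int.lt_iff_add_one_le.mp h2
      have hmax1 : (a : ℝ) ≤ max (a : ℝ) (b : ℝ) := le_max_left _ _
      have hmax2 : (b : ℝ) ≤ max (a : ℝ) (b : ℝ) := le_max_right _ _
      have i1 : |((x 0 : ℝ)) - X₀| ≤ max (a : ℝ) (b : ℝ) := by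
        rw [abs_le]; constructor <;> linarith
      have i2 : |(x 1 : ℝ) + 1 - Y₀| ≤ H := by
        rw [abs_le]; constructor <;> linarith
      linarith
    calc ‖w - triEmbed ![X₀, Y₀]‖ = ‖(w - triEmbed (x + Pi.single 1 1)) + (triEmbed (x + Pi.single 1 1) - triEmbed ![X₀, Y₀])‖ := by
          rw [sub_add_sub_cancel]
      _ ≤ ‖w - triEmbed (x + Pi.single 1 1)‖ + ‖triEmbed (x + Pi.single 1 1) - triEmbed ![X₀, Y₀]‖ := norm_add_le _ _
      _ ≤ 4 + (max a b + H) := add_le_add hd hdiff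
      _ = max a b + H + 4 := by ring
  where
  /-- `0 < √3/2`. [folklore] -/
  sqrt_three_div_two_pos' : (0 : ℝ) < Real.sqrt 3 / 2 := by positivity

/-- **Deep tiles versus deep points** (registered form, sub-goal of `stub_innerZigzagPolygon`): if
`S` is the set of `η₁`-deep tile centres, cells of its tiles are `(η₁ - 4h)`-deep and every cell
containing an `(η₁ + 4h)`-deep point is one of its tile faces. [folklore] -/
theorem deep_tiles : ∀ (Ω : Set ℂ) (o : ℂ) (h η₁ : ℝ) (S : Finset (Site 2)), 0 ≤ h → (∀ c : Site 2, c ∈ S ↔ (c 0 - c 1) % 3 = 0 ∧ η₁ ≤ Metric.infDist (o + h * triEmbed c) Ωᶜ) → (∀ F ∈ tileFaces S, ∀ w ∈ triCell F, η₁ - 4 * h ≤ Metric.infDist (o + h * w) Ωᶜ) ∧ ∀ (F : HexVertex) (w : ℂ), w ∈ triCell F → η₁ + 4 * h ≤ Metric.infDist (o + h * w) Ωᶜ → F ∈ tileFaces S :=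
  fun _ o _ _ _ hh hS =>
    ⟨fun _ hF _ hw => tile_cell_deep o hh (fun c hc => ((hS c).1 hc).2) hF hw,
      fun _ _ hw hd => mem_tileFaces_of_deep o hh (fun c h1 h2 => (hS c).2 ⟨h1, h2⟩) hw hd⟩

end Summit.CriticalPhenomena.SAWScalingLimit.Theorems.PolygonParitySqueeze.InnerZigzag

end
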